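import Literature.Barriers.CriticalPhenomena.RigorousRGSmallParameterRGNorms
import Literature.Barriers.CriticalPhenomena.RigorousRGSmallParameterTphiPolynomial
import Literature.Barriers.CriticalPhenomena.RigorousRGSmallParameterTphiExponential
import HarnessLib

/-!
# `RigorousRGSmallParameter` (Slade, Theorem 1.4.1): the local polynomial `V_x = gτ_x² + ντ_x + u`,
# the norm (6.36) on `𝒰` with the domains (6.37)–(6.38), and the small parameter `ε_V` (§6.4.3)

Companion ("proof architecture") file of
`Literature/Barriers/CriticalPhenomena/RigorousRGSmallParameter.lean`, on top of the norm files
(`…RGNorms`, `…TphiPolynomial`, `…TphiExponential`). Slade's perturbative coordinate is the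
local polynomial `V = gτ² + ντ` (`τ_x = ½|φ_x|²`, §1.2), `U = (g,ν,u) ∈ 𝒰 ≅ ℝ³` (§4.2,
`𝒱(X) = {Σ_{x∈X} U(φ_x)}`); §6.3 puts the norm (6.36) `‖U‖_𝒱 = max{|g|L^{ε(j∧j_m)},
|ν|L^{α(j∧j_m)}, |u|L^{dj}}` on `𝒰` and defines the domains (6.37) `𝒟_j` and (6.38)
`𝔻_j = 𝒟_j × B_{𝒲_j}(C_RG ϑ̃³s̄³)`; §6.4.3 controls the size of `V` for the stability estimates of
[BS-rg-IE] through `ε_V = L^{dj}(‖gτ_x²‖_{T_0(𝔥_j)} + ‖ντ_x‖_{T_0(𝔥_j)})` (6.46), "computation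
gives `ε_V ≍ |g|L^{dj}𝔥_j⁴ + |ν|L^{dj}𝔥_j²`" (6.47). Source: G. Slade, CMP 358 (2018),
arXiv:1611.06169, §1.2, §4.2, §6.3, §6.4.3 (read from the TeX source), with [BS-rg-norm]
Proposition 3.5.1 (`‖τ_x‖_{T_φ}`) for the one-site computation.

## What this file proves (everything; no named fact)

* `ev`, `tau` (`τ_x`), `localPoly` (`V_x`), `localPolySum` (`U(X)`); `VNorm` (6.36), `VDomain`
  (6.37, real `g`), `RGDomain` (6.38);
* the coefficients of `τ_x` for the coordinate directions `e_{(x,i)}` (`dirDeriv_ev`,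
  `dirDeriv_tau`, `coeff_tau_one`, `coeff_tau_two`, `coeff_tau_eq_zero` — degree `2`), hence
  **`TphiNorm_tau_zero_le`**: `‖τ_x‖_{T_0(𝔥)} ≤ ½n𝔥²` (only the `n` diagonal second
  coefficients survive at `φ = 0`);
* **`TphiNorm_localPoly_zero_le`** — the block-level `ε_V` computation
  `‖V_x‖_{T_0(𝔥)} ≤ |g|(½n𝔥²)² + |ν|(½n𝔥²) + |u|` by the product property (file III) for `τ_x²`,
  homogeneity (`TphiNorm_const_mul_le`), constants (`TphiNorm_const_le`, `‖δ_∅‖ ≤ 1`) and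
  subadditivity;
* `coeff_localPoly_eq_zero` (`V_x` has degree `4`) and **`TphiNorm_localPoly_le`** —
  `‖V_x‖_{T_φ} ≤ ‖V_x‖_{T_0}(1 + ‖φ‖_{Φ_j(𝔥)})⁴` by Brydges–Slade Proposition 3.6.1
  (file `…TphiPolynomial`) with the field norm (6.29) of `…RGNorms`.

Ledger effect: none on the trust base of the barrier's reduction chain (`Slade2017_prop822`).
-/

noncomputable section

namespace Literature.Barriers.CriticalPhenomena

namespace LongRangePhi4

namespace LocalPoly

open Finset Tphi RGNorm Literature.Probability.LatticeModels
open scoped ContDiff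

variable {d M n : ℕ} [NeZero M]

/-! ### The field monomials `τ_x = ½|φ_x|²` and the local polynomial `V_x = gτ_x² + ντ_x + u` -/

/-- Evaluation of a field component, `φ ↦ φ^i_x`. [folklore] -/
def ev (p : TorusSite d M × Fin n) : (TorusSite d M → Fin n → ℝ) → ℝ := fun φ => φ p.1 p.2

/-- `τ_x = ½|φ_x|² = ½ Σ_i (φ^i_x)²`. [cite: Slade2017, §1.2 (τ_x = ½|φ_x|²)] -/
def tau (x : TorusSite d M) : (TorusSite d M → Fin n → ℝ) → ℝ := fun φ => 2⁻¹ * ∑ i, φ x i ^ 2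

/-- The local polynomial `V_x = gτ_x² + ντ_x + u` (`U = (g, ν, u) ∈ 𝒰 ≅ ℝ³`).
[cite: Slade2017, §4.2 (the space 𝒰 of local polynomials gτ² + ντ + u)] -/
def localPoly (g ν u : ℝ) (x : TorusSite d M) : (TorusSite d M → Fin n → ℝ) → ℝ :=
  fun φ => g * tau x φ ^ 2 + ν * tau x φ + u

/-- `U(X) = Σ_{x ∈ X} U(φ_x)`. [cite: Slade2017, §4.2 (𝒱(X) = {Σ_{x∈X} U(φ_x)})] -/
def localPolySum (g ν u : ℝ) (X : Finset (TorusSite d M)) : (TorusSite d M → Fin n → ℝ) → ℝ :=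
  fun φ => ∑ x ∈ X, localPoly g ν u x φ

/-! ### The norm on `𝒰` (6.36) and the domains (6.37), (6.38) -/

/-- **Slade (6.36)**: `‖U‖_𝒱 = max{|g|L^{ε(j∧j_m)}, |ν|L^{α(j∧j_m)}, |u|L^{dj}}`.
[cite: Slade2017, §6.3 (display (6.36))] -/
def VNorm (L ε α : ℝ) (d j jm : ℕ) (g ν u : ℝ) : ℝ :=
  max (|g| * L ^ (ε * (min j jm : ℕ))) (max (|ν| * L ^ (α * (min j jm : ℕ))) (|u| * L ^ ((d : ℝ) * j)))

/-- **Slade (6.37), real case**: the domain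
`𝒟_j = {V : ‖V‖_𝒱 ≤ C_𝒟 s̄, g > C_𝒟⁻¹L^{-ε(j∧j_m)}s̄}` (the wedge condition `|Im g| < Re g/10` is
vacuous for real `g > 0`). [cite: Slade2017, §6.3 (display (6.37))] -/
def VDomain (L ε α : ℝ) (d j jm : ℕ) (CD sbar : ℝ) : Set (ℝ × ℝ) :=
  {V | VNorm L ε α d j jm V.1 V.2 0 ≤ CD * sbar ∧ CD⁻¹ * L ^ (-(ε * (min j jm : ℕ))) * sbar < V.1}

/-- **Slade (6.38)**: `𝔻_j = 𝒟_j × B_{𝒲_j}(C_RG ϑ̃_j³ s̄³)` — the renormalisation-group domain, the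
`K`-ball given by a `[0,∞]`-valued norm. [cite: Slade2017, §6.3 (display (6.38))] -/
def RGDomain {𝒦 : Type*} (L ε α : ℝ) (d j jm : ℕ) (CD sbar CRG ϑ : ℝ)
    (Wn : 𝒦 → ENNReal) : Set ((ℝ × ℝ) × 𝒦) :=
  {p | p.1 ∈ VDomain L ε α d j jm CD sbar ∧ Wn p.2 < ENNReal.ofReal (CRG * ϑ ^ 3 * sbar ^ 3)}

/-! ### Coefficients of `τ_x` -/

/-- `ev` is smooth (it is linear). [folklore] -/
theorem contDiff_ev (p : TorusSite d M × Fin n) : ContDiff ℝ ∞ (ev (d := d) (M := M) (n := n) p) := by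
  unfold ev
  exact (contDiff_apply_apply ℝ ℝ p.1 p.2)

/-- `ev p` as a continuous linear map. [folklore] -/
def evCLM (p : TorusSite d M × Fin n) : (TorusSite d M → Fin n → ℝ) →L[ℝ] ℝ :=
  (ContinuousLinearMap.proj (R := ℝ) (φ := fun _ : Fin n => ℝ) p.2).comp
    (ContinuousLinearMap.proj (R := ℝ) (φ := fun _ : TorusSite d M => Fin n → ℝ) p.1)

omit [NeZero M] in
/-- `evCLM p` is `ev p`. [folklore] -/
theorem evCLM_apply (p : TorusSite d M × Fin n) (φ : TorusSite d M → Fin n → ℝ) : evCLM p φ = ev p φ := rfl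

/-- `∂_{e_q} φ^i_x = δ_{q,(x,i)}`. [folklore] -/
theorem dirDeriv_ev (p q : TorusSite d M × Fin n) :
    dirDeriv (basisDir d M n q) (ev p) = fun _ => if p = q then 1 else 0 := by
  funext φ
  unfold dirDeriv
  have h : HasFDerivAt (ev (d := d) (M := M) (n := n) p) (evCLM p) φ := (evCLM p).hasFDerivAt
  rw [h.fderiv, evCLM_apply]
  simp only [ev, basisDir]
  by_cases hpq : p = q
  · subst hpq; simp
  · rw [if_neg, if_neg hpq]
    rintro ⟨h1, h2⟩
    exact hpq (Prod.ext h1 h2)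

/-- `τ_x` is smooth. [folklore] -/
theorem contDiff_tau (x : TorusSite d M) : ContDiff ℝ ∞ (tau (d := d) (M := M) (n := n) x) := by
  unfold tau
  exact contDiff_const.mul (ContDiff.sum fun i _ => (contDiff_apply_apply ℝ ℝ x i).pow 2)

/-- `∂_v(cF) = c ∂_vF`. [folklore] -/
theorem dirDeriv_const_mul {E : Type*} [NormedAddCommGroup E] [NormedSpace ℝ E] (v : E) (c : ℝ)
    {F : E → ℝ} (hF : Differentiable ℝ F) : dirDeriv v (fun φ => c * F φ) = fun φ => c * dirDeriv v F φ := by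
  funext φ
  simp only [dirDeriv]
  rw [show (fun φ => c * F φ) = fun φ => c • F φ from rfl, fderiv_fun_const_smul (hF φ)]
  simp [smul_eq_mul]

/-- `∂_v Σ_i F_i = Σ_i ∂_v F_i`. [folklore] -/
theorem dirDeriv_finset_sum {E : Type*} [NormedAddCommGroup E] [NormedSpace ℝ E] (v : E) {β : Type*}
    (s : Finset β) {F : β → E → ℝ} (hF : ∀ i ∈ s, Differentiable ℝ (F i)) :
    dirDeriv v (fun φ => ∑ i ∈ s, F i φ) = fun φ => ∑ i ∈ s, dirDeriv v (F i) φ := by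
  funext φ
  simp only [dirDeriv]
  rw [fderiv_fun_sum fun i hi => (hF i hi) φ]
  simp

/-- `∂_{e_q} τ_x = 𝟙_{q.1 = x} φ_q`. [folklore] -/
theorem dirDeriv_tau (x : TorusSite d M) (q : TorusSite d M × Fin n) :
    dirDeriv (basisDir d M n q) (tau x) = fun φ => if q.1 = x then ev q φ else 0 := by
  have h : tau (d := d) (M := M) (n := n) x = fun φ => 2⁻¹ * ∑ i, ev (x, i) φ * ev (x, i) φ := by
    funext φ; simp [tau, ev, sq]
  have hd : ∀ i, Differentiable ℝ (ev (d := d) (M := M) (n := n) (x, i)) := fun i =>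
    differentiable_of_contDiff (contDiff_ev (x, i))
  have hdi : ∀ i, Differentiable ℝ (fun φ => ev (d := d) (M := M) (n := n) (x, i) φ * ev (x, i) φ) :=
    fun i => (hd i).mul (hd i)
  have hdiff : Differentiable ℝ (fun φ => ∑ i, ev (d := d) (M := M) (n := n) (x, i) φ * ev (x, i) φ) :=
    Differentiable.fun_sum fun i _ => hdi i
  rw [h, dirDeriv_const_mul (basisDir d M n q) 2⁻¹ hdiff,
    dirDeriv_finset_sum (basisDir d M n q) Finset.univ (F := fun i φ => ev (x, i) φ * ev (x, i) φ)
      (fun i _ => hdi i)]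
  funext φ
  simp only [dirDeriv_mul _ (hd _) (hd _), dirDeriv_ev]
  by_cases hq : q.1 = x
  · rw [if_pos hq, Finset.sum_eq_single q.2]
    · have : (x, q.2) = q := by rw [← hq]
      rw [this]; simp; ring
    · intro i _ hi
      rw [if_neg]; · ring
      intro h'; apply hi; rw [← h']
    · intro h'; exact absurd (mem_univ _) h'
  · rw [if_neg hq, Finset.sum_eq_zero]; · ring
    intro i _
    rw [if_neg]; · ring
    intro h'; apply hq; rw [← h']

/-- The first coefficient of `τ_x`. [folklore] -/
theorem coeff_tau_one (x : TorusSite d M) (q : TorusSite d M × Fin n) :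
    coeff (basisDir d M n) [q] (tau x) = fun φ => if q.1 = x then ev q φ else 0 := by
  rw [coeff_cons, coeff_nil, dirDeriv_tau]

/-- The second coefficients of `τ_x` are the constants `(τ_x)_{(q',q)} = 𝟙_{q.1 = x} δ_{qq'}`. [folklore] -/
theorem coeff_tau_two (x : TorusSite d M) (q q' : TorusSite d M × Fin n) :
    coeff (basisDir d M n) [q', q] (tau x) = fun _ => if q.1 = x ∧ q = q' then 1 else 0 := by
  rw [coeff_cons, coeff_tau_one]
  funext φ
  by_cases hq : q.1 = x
  · simp only [hq, true_and, if_true]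
    exact congrFun (dirDeriv_ev (d := d) (M := M) (n := n) q q') φ
  · simp only [hq, false_and, if_false]
    simp [dirDeriv]

/-- Coefficients of `τ_x` of length `≥ 3` vanish identically: `τ_x` is a polynomial of degree `2`. [folklore] -/
theorem coeff_tau_eq_zero (x : TorusSite d M) :
    ∀ z : List (TorusSite d M × Fin n), 2 < z.length → coeff (basisDir d M n) z (tau x) = fun _ => 0
  | [], h => by simp at h
  | [_], h => by simp at h
  | [_, _], h => by simp at h
  | [a, q', q], _ => by
      rw [coeff_cons, coeff_tau_two]
      funext φ; simp [dirDeriv]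
  | a :: b :: c :: e :: z, _ => by
      rw [coeff_cons, coeff_tau_eq_zero x (b :: c :: e :: z) (by simp)]
      funext φ; simp [dirDeriv]

/-! ### `‖τ_x‖_{T_0(𝔥)} ≤ ½ n 𝔥²` and the small parameter `ε_V` -/

/-- The coefficient family of `τ_x` at `φ = 0` vanishes except on diagonal sequences of length
two at site `x`, where it is `1`. [folklore] -/
theorem abs_coeffFamily_tau_zero_le (x : TorusSite d M) (z : List (TorusSite d M × Fin n)) :
    |coeffFamily (basisDir d M n) (tau x) 0 z| ≤
      (match z with
      | [q', q] => if q.1 = x ∧ q = q' then 1 else 0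
      | _ => 0) := by
  unfold coeffFamily
  match z with
  | [] => simp [tau]
  | [q] => rw [coeff_tau_one]; simp [ev]
  | [q', q] =>
      rw [coeff_tau_two]
      by_cases h : (q.1 = x ∧ q = q')
      · obtain ⟨h1, rfl⟩ := h
        simp [h1]
      · rw [if_neg h]; simp [h]
  | a :: b :: c :: z => rw [coeff_tau_eq_zero x _ (by simp)]; simp

/-- `Σ_{q',q} 𝟙_{q.1 = x, q = q'} t = n t`. [folklore] -/
theorem sumSeq_two_diag (x : TorusSite d M) (t : ℝ) :
    sumSeq 2 (fun z : List (TorusSite d M × Fin n) =>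
      (match z with
      | [q', q] => if q.1 = x ∧ q = q' then (1:ℝ) else 0
      | _ => 0) * t) = n * t := by
  simp only [sumSeq_succ, sumSeq_zero]
  have inner : ∀ a : TorusSite d M × Fin n,
      ∑ b : TorusSite d M × Fin n, (if b.1 = x ∧ b = a then (1:ℝ) else 0) * t =
        (if a.1 = x then 1 else 0) * t := by
    intro a
    rw [Finset.sum_eq_single a]
    · simp
    · intro b _ hba
      rw [if_neg]; · simp
      rintro ⟨_, h⟩; exact hba h
    · intro h; exact absurd (mem_univ _) h
  simp only [inner]
  rw [← Finset.sum_mul, Fintype.sum_prod_type]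
  congr 1
  rw [Finset.sum_comm]
  simp only [Finset.sum_ite_eq', Finset.mem_univ, if_true, Finset.sum_const, Finset.card_univ,
    Fintype.card_fin, nsmul_eq_mul, mul_one]

/-- **`‖τ_x‖_{T_0(𝔥)} ≤ ½ n 𝔥²`** (cf. "`‖τ_x‖_{T_φ} = (|φ_x|+𝔥)² + 𝔥²`", Proposition 3.5.1 of
[BS-rg-norm], for the complex field; here the `n`-component real field at `φ = 0`: only the `n`
diagonal second coefficients contribute, each test-function value being at most `𝔥²`).
[cite: BrydgesSlade2015RGI, Proposition 3.5.1] [cite: Slade2017, §6.4.3 (the computation ε_V ≍ |g|L^{dj}𝔥_j⁴ + |ν|L^{dj}𝔥_j²)] -/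
theorem TphiNorm_tau_zero_le {𝔥 R : ℝ} (h𝔥 : 0 < 𝔥) (hR : 0 < R) (pΦ pN : ℕ) (x : TorusSite d M) :
    TphiNorm pN (latticeFamily (unitStep d M) 𝔥 R pΦ) (basisDir d M n) (tau x) 0 ≤ 2⁻¹ * n * 𝔥 ^ 2 := by
  unfold TphiNorm
  refine Tnorm_le fun g hg => ?_
  have hev := latticeFamily_evalBound (unitStep d M) h𝔥 hR pΦ pN (ι := Fin n) g hg
  set ind : List (TorusSite d M × Fin n) → ℝ := fun z =>
    match z with
    | [q', q] => if q.1 = x ∧ q = q' then (1:ℝ) else 0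
    | _ => 0 with hind
  have hind0 : ∀ z : List (TorusSite d M × Fin n), z.length ≠ 2 → ind z = 0 := by
    intro z hz
    match z, hz with
    | [], _ => rfl
    | [_], _ => rfl
    | [_, _], hz => simp at hz
    | _ :: _ :: _ :: _, _ => rfl
  calc |pairing pN (coeffFamily (basisDir d M n) (tau x) 0) g|
      ≤ ∑ r ∈ range (pN + 1), ((r.factorial : ℝ)⁻¹) *
          sumSeq r (fun z => |coeffFamily (basisDir d M n) (tau x) 0 z| * 𝔥 ^ r) :=
        abs_pairing_le pN _ g (fun r => 𝔥 ^ r) (fun z hz => hev z hz)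
    _ ≤ ∑ r ∈ range (pN + 1), ((r.factorial : ℝ)⁻¹) * sumSeq r (fun z => ind z * 𝔥 ^ r) := by
        refine Finset.sum_le_sum fun r _ => mul_le_mul_of_nonneg_left
          (sumSeq_mono r fun z _ => mul_le_mul_of_nonneg_right ?_ (by positivity)) (by positivity)
        exact abs_coeffFamily_tau_zero_le x z
    _ = ∑ r ∈ range (pN + 1), (if r = 2 then 2⁻¹ * n * 𝔥 ^ 2 else 0) := by
        refine Finset.sum_congr rfl fun r _ => ?_
        by_cases hr : r = 2
        · subst hr
          rw [if_pos rfl, sumSeq_two_diag x (𝔥 ^ 2)]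
          simp [Nat.factorial]
          ring
        · rw [if_neg hr, sumSeq_congr r (g := fun _ => 0), sumSeq_zero_fun, mul_zero]
          intro z hz
          rw [hind0 z (by omega), zero_mul]
    _ ≤ 2⁻¹ * n * 𝔥 ^ 2 := by
        rw [Finset.sum_ite_eq']
        split_ifs
        · exact le_rfl
        · positivity

/-- Coefficients of a constant vanish beyond the empty sequence. [folklore] -/
theorem coeff_const_eq_zero {E : Type*} [NormedAddCommGroup E] [NormedSpace ℝ E] {Ξ : Type*} (e : Ξ → E)
    (u : ℝ) : ∀ z : List Ξ, z ≠ [] → coeff e z (fun _ : E => u) = fun _ => 0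
  | [], h => absurd rfl h
  | [a], _ => by funext φ; simp [coeff_cons, dirDeriv]
  | a :: b :: z, _ => by
      rw [coeff_cons, coeff_const_eq_zero e u (b :: z) (by simp)]
      funext φ; simp [dirDeriv]

/-- `‖u‖_{T_φ} ≤ |u|` for a constant `u` (lattice norms: `‖δ_∅‖_T ≤ 1`). [folklore] -/
theorem TphiNorm_const_le {𝔥 R : ℝ} (h𝔥 : 0 < 𝔥) (hR : 0 < R) (pΦ pN : ℕ) (u : ℝ)
    (φ : TorusSite d M → Fin n → ℝ) :
    TphiNorm pN (latticeFamily (unitStep d M) 𝔥 R pΦ) (basisDir d M n) (fun _ => u) φ ≤ |u| := by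
  unfold TphiNorm
  have h : coeffFamily (basisDir d M n) (fun _ : TorusSite d M → Fin n → ℝ => u) φ =
      fun z => u * unitFam z := by
    funext z
    by_cases hz : z = []
    · subst hz; simp [coeffFamily, unitFam]
    · simp [coeffFamily, coeff_const_eq_zero _ u z hz, unitFam, hz]

  rw [h]
  refine (Tnorm_smul_le (latticeFamily_evalBound (unitStep d M) h𝔥 hR pΦ pN) u _).trans ?_
  have := Tnorm_unitFam_le_one (unitStep d M) h𝔥 hR pΦ pN (ι := Fin n) (Λ := TorusSite d M)
  calc |u| * Tnorm pN (latticeFamily (unitStep d M) 𝔥 R pΦ) unitFam ≤ |u| * 1 := by gcongr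
    _ = |u| := mul_one _

/-- `‖cF‖_{T_φ} ≤ |c|‖F‖_{T_φ}`. [folklore] -/
theorem TphiNorm_const_mul_le {𝔥 R : ℝ} (h𝔥 : 0 < 𝔥) (hR : 0 < R) (pΦ pN : ℕ) (c : ℝ)
    {F : (TorusSite d M → Fin n → ℝ) → ℝ} (hF : ContDiff ℝ ∞ F) (φ : TorusSite d M → Fin n → ℝ) :
    TphiNorm pN (latticeFamily (unitStep d M) 𝔥 R pΦ) (basisDir d M n) (fun ψ => c * F ψ) φ ≤
      |c| * TphiNorm pN (latticeFamily (unitStep d M) 𝔥 R pΦ) (basisDir d M n) F φ := by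
  unfold TphiNorm
  have h : coeffFamily (basisDir d M n) (fun ψ => c * F ψ) φ = fun z => c * coeffFamily (basisDir d M n) F φ z := by
    funext z; simp [coeffFamily, coeff_const_mul _ hF c z]
  rw [h]
  exact Tnorm_smul_le (latticeFamily_evalBound (unitStep d M) h𝔥 hR pΦ pN) c _

/-- `V_x` is smooth. [folklore] -/
theorem contDiff_localPoly (g ν u : ℝ) (x : TorusSite d M) :
    ContDiff ℝ ∞ (localPoly (d := d) (M := M) (n := n) g ν u x) := by
  unfold localPoly
  exact ((contDiff_const.mul ((contDiff_tau x).pow 2)).add (contDiff_const.mul (contDiff_tau x))).add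
    contDiff_const

/-- **The small parameter `ε_V` at the block level**: for the local polynomial
`V_x = gτ_x² + ντ_x + u`, `‖V_x‖_{T_0(𝔥)} ≤ |g|(½n𝔥²)² + |ν|(½n𝔥²) + |u|` — the computation
"`ε_V ≍ |g|L^{dj}𝔥_j⁴ + |ν|L^{dj}𝔥_j²`" of Slade (§6.4.3, display after (6.46)) for one site
(summing over the `L^{dj}` sites of a block gives the factor `L^{dj}`), by the product property
for `τ_x²`, homogeneity and subadditivity. [cite: Slade2017, §6.4.3 (displays (6.46)–(6.47): ε_V = L^{dj}(‖gτ_x²‖_{T_0} + ‖ντ_x‖_{T_0}) ≍ |g|L^{dj}𝔥⁴ + |ν|L^{dj}𝔥²)] -/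
theorem TphiNorm_localPoly_zero_le {𝔥 R : ℝ} (h𝔥 : 0 < 𝔥) (hR : 0 < R) (pΦ pN : ℕ) (g ν u : ℝ)
    (x : TorusSite d M) :
    TphiNorm pN (latticeFamily (unitStep d M) 𝔥 R pΦ) (basisDir d M n) (localPoly g ν u x) 0 ≤
      |g| * (2⁻¹ * n * 𝔥 ^ 2) ^ 2 + |ν| * (2⁻¹ * n * 𝔥 ^ 2) + |u| := by
  have hτ := contDiff_tau (d := d) (M := M) (n := n) x
  have hτ2 : ContDiff ℝ ∞ (fun ψ => tau (d := d) (M := M) (n := n) x ψ * tau x ψ) := hτ.mul hτ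
  have h1 := TphiNorm_tau_zero_le (n := n) h𝔥 hR pΦ pN x
  have h0 : 0 ≤ TphiNorm pN (latticeFamily (unitStep d M) 𝔥 R pΦ) (basisDir d M n) (tau x) 0 :=
    TphiNorm_nonneg _ _ _ _ _
  unfold localPoly
  calc TphiNorm pN (latticeFamily (unitStep d M) 𝔥 R pΦ) (basisDir d M n)
        (fun φ => g * tau x φ ^ 2 + ν * tau x φ + u) 0
      ≤ TphiNorm pN (latticeFamily (unitStep d M) 𝔥 R pΦ) (basisDir d M n)
          (fun φ => g * tau x φ ^ 2 + ν * tau x φ) 0 +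
        TphiNorm pN (latticeFamily (unitStep d M) 𝔥 R pΦ) (basisDir d M n) (fun _ => u) 0 :=
        TphiNorm_add_le_lattice (unitStep d M) h𝔥 hR pΦ pN (basisDir d M n)
          ((contDiff_const.mul (hτ.pow 2)).add (contDiff_const.mul hτ)) contDiff_const 0
    _ ≤ (TphiNorm pN (latticeFamily (unitStep d M) 𝔥 R pΦ) (basisDir d M n) (fun φ => g * tau x φ ^ 2) 0 +
          TphiNorm pN (latticeFamily (unitStep d M) 𝔥 R pΦ) (basisDir d M n) (fun φ => ν * tau x φ) 0) + |u| := by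
        gcongr
        · exact TphiNorm_add_le_lattice (unitStep d M) h𝔥 hR pΦ pN (basisDir d M n)
            (contDiff_const.mul (hτ.pow 2)) (contDiff_const.mul hτ) 0
        · exact TphiNorm_const_le h𝔥 hR pΦ pN u 0
    _ ≤ (|g| * (2⁻¹ * n * 𝔥 ^ 2) ^ 2 + |ν| * (2⁻¹ * n * 𝔥 ^ 2)) + |u| := by
        gcongr
        · calc TphiNorm pN (latticeFamily (unitStep d M) 𝔥 R pΦ) (basisDir d M n) (fun φ => g * tau x φ ^ 2) 0
              ≤ |g| * TphiNorm pN (latticeFamily (unitStep d M) 𝔥 R pΦ) (basisDir d M n) (fun φ => tau x φ ^ 2) 0 :=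
                TphiNorm_const_mul_le h𝔥 hR pΦ pN g (hτ.pow 2) 0
            _ ≤ |g| * (2⁻¹ * n * 𝔥 ^ 2) ^ 2 := by
                gcongr
                rw [show (fun φ => tau (d := d) (M := M) (n := n) x φ ^ 2) = fun φ => tau x φ * tau x φ from by
                  funext φ; ring, sq]
                calc _ ≤ TphiNorm pN (latticeFamily (unitStep d M) 𝔥 R pΦ) (basisDir d M n) (tau x) 0 *
                      TphiNorm pN (latticeFamily (unitStep d M) 𝔥 R pΦ) (basisDir d M n) (tau x) 0 :=
                      TphiNorm_mul_le_lattice (unitStep d M) h𝔥 hR pΦ pN (basisDir d M n) hτ hτ 0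
                  _ ≤ (2⁻¹ * n * 𝔥 ^ 2) * (2⁻¹ * n * 𝔥 ^ 2) := by gcongr
        · calc TphiNorm pN (latticeFamily (unitStep d M) 𝔥 R pΦ) (basisDir d M n) (fun φ => ν * tau x φ) 0
              ≤ |ν| * TphiNorm pN (latticeFamily (unitStep d M) 𝔥 R pΦ) (basisDir d M n) (tau x) 0 :=
                TphiNorm_const_mul_le h𝔥 hR pΦ pN ν hτ 0
            _ ≤ |ν| * (2⁻¹ * n * 𝔥 ^ 2) := by gcongr

/-- The coefficients of `V_x` of length `> 4` vanish: `V_x` is a polynomial of degree `4`. [folklore] -/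
theorem coeff_localPoly_eq_zero (g ν u : ℝ) (x : TorusSite d M) (z : List (TorusSite d M × Fin n))
    (hz : 4 < z.length) : ∀ ψ, coeff (basisDir d M n) z (localPoly g ν u x) ψ = 0 := by
  intro ψ
  have hτ := contDiff_tau (d := d) (M := M) (n := n) x
  have hsq : (fun φ => tau (d := d) (M := M) (n := n) x φ ^ 2) = fun φ => tau x φ * tau x φ := by
    funext φ; ring
  unfold localPoly
  rw [coeff_add _ ((contDiff_const.mul (hτ.pow 2)).add (contDiff_const.mul hτ)) contDiff_const,
    coeff_add _ (contDiff_const.mul (hτ.pow 2)) (contDiff_const.mul hτ)]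
  have h1 : coeff (basisDir d M n) z (fun ψ => g * tau x ψ ^ 2) =
      fun ψ => g * coeff (basisDir d M n) z (fun φ => tau x φ ^ 2) ψ := coeff_const_mul _ (hτ.pow 2) g z
  have h2 : coeff (basisDir d M n) z (fun ψ => ν * tau x ψ) =
      fun ψ => ν * coeff (basisDir d M n) z (tau x) ψ := coeff_const_mul _ hτ ν z
  simp only []
  rw [h1, h2, hsq, coeff_mul _ hτ hτ, coeff_tau_eq_zero x z (by omega),
    coeff_const_eq_zero _ u z (by rintro rfl; simp at hz)]
  simp only [mul_zero, add_zero]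
  rw [List.sum_eq_zero, mul_zero]
  intro t ht
  rw [List.mem_map] at ht
  obtain ⟨p, hp, rfl⟩ := ht
  have hlen := length_add_of_mem_splits hp
  rcases Nat.lt_or_ge 2 p.1.length with h1 | h1
  · rw [coeff_tau_eq_zero x p.1 h1]; simp
  · rw [coeff_tau_eq_zero x p.2 (by omega)]; simp

/-- **`‖V_x‖_{T_φ} ≤ ‖V_x‖_{T_0}(1 + ‖φ‖_{Φ_j})⁴`** for the local polynomial `V_x` (degree `4`,
`p_𝒩 ≥ 4`): Brydges–Slade Proposition 3.6.1 applied to `V_x`, the field norm of `φ` entering as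
in (6.29). [cite: BrydgesSlade2015RGI, Proposition 3.6.1] [cite: Slade2017, §6.4.3 (stability domains for V as in [BS-rg-IE])] -/
theorem TphiNorm_localPoly_le {𝔥 R : ℝ} (h𝔥 : 0 < 𝔥) (hR : 0 < R) {pΦ pN : ℕ} (hpN : 4 ≤ pN)
    (g ν u : ℝ) (x : TorusSite d M) (φ : TorusSite d M → Fin n → ℝ) [Nonempty (Fin n)] :
    TphiNorm pN (latticeFamily (unitStep d M) 𝔥 R pΦ) (basisDir d M n) (localPoly g ν u x) φ ≤
      TphiNorm pN (latticeFamily (unitStep d M) 𝔥 R pΦ) (basisDir d M n) (localPoly g ν u x) 0 *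
        (1 + fieldNorm 𝔥 R pΦ φ) ^ 4 := by
  have h := TphiNorm_le_TphiNorm_zero_mul (unitStep d M) h𝔥 hR hpN (basisDir d M n)
    (contDiff_localPoly g ν u x) (fun z hz ψ => coeff_localPoly_eq_zero g ν u x z hz ψ)
    (fieldFn φ) (fieldNorm_nonneg h𝔥.le pΦ φ)
    (fun y β hβ => napply_le_of_fieldNorm_le h𝔥 hR le_rfl y β hβ)
  rwa [sum_fieldFn_smul_basisDir] at h

end LocalPoly

end LongRangePhi4

end Literature.Barriers.CriticalPhenomena

end
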